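import Literature.NumberTheory.EllipticCurves.KubertTateFiveMuDescentBox
import Literature.NumberTheory.EllipticCurves.KubertTateFiveRationalTorsion
import HarnessLib

/-!
# `t₅ = 0` and RANK `1` by descent alone: the Kubert–Tate curve `E_{17/2} = [−15, −34, −68, 0, 0]`

PROOF-ONLY file (theorems only, no definition, no named fact, no `sorry`), topic `NumberTheory/EllipticCurves`; an INSTANCE of
the `μ₅`-descent box criterion (`KubertTateMuDescent.shaCorank_five_eq_zero_of_matrix` and siblings, files
`KubertTateFiveMuDescent[Box]`) on the Kubert–Tate `X₁(5)`-family `E_{m,n} : y² + (n − m)xy − mn²y = x³ − mnx²`, at `(m, n) = (17, 2)`: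

  `E = E_{17/2} = kubertTateFive 17 2 = [−15, −34, −68, 0, 0]`, i.e. `y² − 15xy − 68y = x³ − 34x²`, `Δ = −2⁵·17⁵·89`, `T = (0,0)` of order `5`.

TAME: `5 ∤ Δ` and the bad primes `2, 17, 89` are `≢ 1 (mod 5)`. BOX: `S = {2, 17}` (`ω(mn) = 2`); the rational points `−T = (0, 68)` and
`P₁ = (3910, 274550)` have `f_T = xy − 2x² + 4y` equal to `272 = 2⁴·17`, `1044012500 = 2²·5⁵·17⁴`; the base point `2T = (34, 578)` has
`f_T = 19652 = 2²·17³`; the `2×2` matrix of valuation differences mod `5`, `M = [[2, 3], [0, 1]]`, is invertible (inverse `[[3, 1], [0, 1]]`).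
Hence, with NO `L`-function, `p`-adic or conjectural input:

* `shaCorank_five_eq_zero` — **`t₅(E_{17/2}) = 0`**; `sha_torsionBy_five_eq_bot` — `Ш(E/ℚ)[5] = 0`;
* `mordellWeilRank_eq` — **`rank E_{17/2}(ℚ) = 1`** (`#E(ℚ)[5] = 5` by reduction modulo `3`).

This curve is the base of the `ℚ(√−2)`-twist row `E_{17/2}^{(−8)}` (rank `1`, `t₅ = 0`, non-anomalous at `5`; sequels
`KubertTate172SqrtNegTwo*`), an instrument for stmt-BirchSwinnertonDyer-22356 («T»); BSD is not proved by this.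

## References

* [SilvermanAEC2009] J. H. Silverman, *AEC*, 2nd ed., Thm. X.4.2, Prop. X.4.9, Exercise 10.1, Thm. X.1.1, VII.3.1(b).
* [Fisher2001FiveSevenDescent] T. Fisher, *Some examples of 5 and 7 descent for elliptic curves over ℚ*, JEMS 3 (2001), §§1–2.
* [Kubert1976] D. S. Kubert, *Universal bounds on the torsion of elliptic curves*, Table 3 (`N = 5`).
-/

noncomputable section

open scoped AddSubgroup
open WeierstrassCurve
open Literature.NumberTheory.EllipticCurves Literature.NumberTheory.EllipticCurves.KubertTateVelu

namespace Literature.NumberTheory.EllipticCurves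

namespace KubertTate172Descent

/-! ## §1 The curve: coefficients, discriminant, tameness -/

/-- `E_{17/2} = [−15, −34, −68, 0, 0]`. [cite: Kubert1976, Table 3 (N = 5)] -/
theorem curve_eq : kubertTateFive (((17 : ℤ) : ℚ)) (((2 : ℤ) : ℚ)) = ⟨-15, -34, -68, 0, 0⟩ := by
  ext <;> simp [kubertTateFive] <;> norm_num

/-- `Δ(E_{17/2}) = −4043752736 = −2⁵·17⁵·89` (integer model). [cite: Kubert1976, Table 3 (N = 5)] -/
theorem Δ_int : (kubertTateFive (17 : ℤ) 2).Δ = -4043752736 := by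
  rw [kubertTateFive_Δ]; norm_num

/-- `E_{17/2}` is an elliptic curve (`Δ ≠ 0`). [cite: Kubert1976, Table 3 (N = 5)] -/
theorem isElliptic : (kubertTateFive (((17 : ℤ) : ℚ)) (((2 : ℤ) : ℚ))).IsElliptic := by
  refine ⟨isUnit_iff_ne_zero.mpr ?_⟩
  rw [eq_map_int (17) 2, map_Δ, Δ_int]
  norm_num

/-- `5 ∤ Δ`: good reduction at `5`. [cite: Fisher2001FiveSevenDescent, §2] -/
theorem not_five_dvd_Δ : ¬ (5 : ℤ) ∣ (kubertTateFive (17 : ℤ) 2).Δ := by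
  rw [Δ_int]; norm_num

/-- `3 ∤ Δ`: good reduction at `3` (used for the rational torsion). [cite: SilvermanAEC2009, VII.3.1(b)] -/
theorem not_tor_dvd_Δ : ¬ ((3 : ℕ) : ℤ) ∣ (kubertTateFive (17 : ℤ) 2).Δ := by
  rw [Δ_int]; norm_num

/-- **TAME**: every bad prime (`2, 17, 89`) is `≢ 1 (mod 5)`. [cite: Fisher2001FiveSevenDescent, §2] -/
theorem tame : ∀ p : ℕ, p.Prime → (p : ℤ) ∣ (kubertTateFive (17 : ℤ) 2).Δ → p % 5 ≠ 1 := by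
  intro p hp hdvd
  rw [Δ_int] at hdvd
  have hdvdN : p ∣ 2 ^ 5 * 17 ^ 5 * 89 := by
    have h' : (p : ℤ) ∣ ((2 ^ 5 * 17 ^ 5 * 89 : ℕ) : ℤ) := by
      have e : ((2 ^ 5 * 17 ^ 5 * 89 : ℕ) : ℤ) = 4043752736 := by norm_num
      rw [e]; exact (Int.dvd_neg.mpr hdvd)
    exact Int.natCast_dvd_natCast.mp h'
  have hpi := Nat.Prime.prime hp
  rcases hpi.dvd_or_dvd hdvdN with h | h
  · rcases hpi.dvd_or_dvd h with h | h
    · have := (Nat.prime_dvd_prime_iff_eq hp Nat.prime_two).mp (hpi.dvd_of_dvd_pow h); omega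
    · have := (Nat.prime_dvd_prime_iff_eq hp (by norm_num : Nat.Prime 17)).mp (hpi.dvd_of_dvd_pow h); omega
  · have := (Nat.prime_dvd_prime_iff_eq hp (by norm_num : Nat.Prime 89)).mp h; omega

/-- `S = ` the prime factors of `|mn| = 34`: `{2, 17}`. [folklore] -/
private theorem primeFactors_eq : ((17 : ℤ) * 2).natAbs.primeFactors = {2, 17} := by
  have e : ((17 : ℤ) * 2).natAbs = 2 * 17 := by norm_num
  rw [e]
  ext p
  simp only [Nat.mem_primeFactors, Finset.mem_insert, Finset.mem_singleton]
  constructor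
  · rintro ⟨hp, hdvd, -⟩
    have hpi := Nat.Prime.prime hp
    rcases hpi.dvd_or_dvd hdvd with h | h
    · exact Or.inl ((Nat.prime_dvd_prime_iff_eq hp Nat.prime_two).mp h)
    · exact Or.inr ((Nat.prime_dvd_prime_iff_eq hp (by norm_num : Nat.Prime 17)).mp h)
  · rintro (rfl | rfl) <;> norm_num

/-! ## §2 The affine equation and the points -/

/-- The affine equation of `E_{17/2}`: `y² − 15xy − 68y = x³ − 34x²`. [cite: Kubert1976, Table 3 (N = 5)] -/
theorem nonsingular_iff (x y : ℚ) :
    (kubertTateFive (((17 : ℤ) : ℚ)) (((2 : ℤ) : ℚ))).toAffine.Nonsingular x y ↔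
      y ^ 2 - 15 * x * y - 68 * y = x ^ 3 - 34 * x ^ 2 := by
  have hΔ : (kubertTateFive (((17 : ℤ) : ℚ)) (((2 : ℤ) : ℚ))).Δ ≠ 0 := isElliptic.isUnit.ne_zero
  rw [← Affine.equation_iff_nonsingular_of_Δ_ne_zero hΔ, Affine.equation_iff]
  simp only [kubertTateFive_a₁, kubertTateFive_a₂, kubertTateFive_a₃, kubertTateFive_a₄,
    kubertTateFive_a₆]
  push_cast
  constructor <;> intro h <;> linear_combination h

/-- The points `−T = (0, 68)`, `P₁ = (3910, 274550)` and the base point `2T = (34, 578)` lie on `E_{17/2}` (checked by `norm_num`). [folklore] -/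
private theorem nonsingular_points :
    (kubertTateFive (((17 : ℤ) : ℚ)) (((2 : ℤ) : ℚ))).toAffine.Nonsingular 0 68 ∧
    (kubertTateFive (((17 : ℤ) : ℚ)) (((2 : ℤ) : ℚ))).toAffine.Nonsingular 3910 274550 ∧
    (kubertTateFive (((17 : ℤ) : ℚ)) (((2 : ℤ) : ℚ))).toAffine.Nonsingular 34 578 := by
  refine ⟨(nonsingular_iff _ _).mpr ?_, (nonsingular_iff _ _).mpr ?_, (nonsingular_iff _ _).mpr ?_⟩ <;> norm_num

/-- `P₁ = (3910, 274550) ∈ E_{17/2}(ℚ)`. [cite: SilvermanAEC2009, VIII.§1] -/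
theorem nonsingular_P₁ : (kubertTateFive (((17 : ℤ) : ℚ)) (((2 : ℤ) : ℚ))).toAffine.Nonsingular 3910 274550 :=
  nonsingular_points.2.1

/-! ## §3 The valuation matrix -/

/-- `v_p(± p^k u) = k` for `p ∤ u` (evaluation of `padicValRat` on a factorised integer). [folklore] -/
private theorem padicValRat_eq_of_eq {p : ℕ} [hp : Fact p.Prime] {a : ℚ} (k : ℕ) {u : ℕ} (s : ℤ)
    (hs : s = 1 ∨ s = -1) (hu : ¬ p ∣ u) (h : a = s * (p : ℚ) ^ k * u) : padicValRat p a = k := by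
  have hu0 : u ≠ 0 := by rintro rfl; exact hu (dvd_zero p)
  have hp0 : (p : ℚ) ≠ 0 := Nat.cast_ne_zero.mpr hp.out.ne_zero
  have hs0 : (s : ℚ) ≠ 0 := by rcases hs with rfl | rfl <;> norm_num
  have hsv : padicValRat p (s : ℚ) = 0 := by
    rcases hs with rfl | rfl
    · simp
    · rw [Int.cast_neg, Int.cast_one, padicValRat.neg, padicValRat.one]
  rw [h, padicValRat.mul (mul_ne_zero hs0 (pow_ne_zero _ hp0)) (Nat.cast_ne_zero.mpr hu0),
    padicValRat.mul hs0 (pow_ne_zero _ hp0), hsv, padicValRat.pow (p : ℚ),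
    padicValRat.self hp.out.one_lt, padicValRat.of_nat, padicValNat.eq_zero_of_not_dvd hu]
  simp

/-- The `f_T`-values `f_T = xy − 2x² + 4y` of the points (`272`, `1044012500`) and of the base point `2T` (`19652`).
[cite: SilvermanAEC2009, Exercise 10.1(c)] -/
theorem kummerValues :
    (∀ i : Fin 2, ![(0 : ℚ), 3910] i * ![(68 : ℚ), 274550] i - (((2 : ℤ) : ℚ)) * ![(0 : ℚ), 3910] i ^ 2 +
      (((2 : ℤ) : ℚ)) ^ 2 * ![(68 : ℚ), 274550] i = ![(272 : ℚ), 1044012500] i) ∧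
    ((34 : ℚ) * 578 - (((2 : ℤ) : ℚ)) * (34) ^ 2 + (((2 : ℤ) : ℚ)) ^ 2 * 578 = (19652 : ℚ)) := by
  refine ⟨fun i ↦ ?_, by norm_num⟩
  fin_cases i <;> simp <;> norm_num

/-- The valuations at `S = (2, 17)`: rows `[[4, 1], [2, 4]]` for the points and `[2, 3]` for the base point `2T`
(`272 = 2⁴·17`, `1044012500 = 2²·5⁵·17⁴`, `19652 = 2²·17³`). [cite: SilvermanAEC2009, Exercise 10.1(c)] -/
theorem valuations :
    (∀ i j : Fin 2, padicValRat (![2, 17] j) (![(272 : ℚ), 1044012500] i) = ((![![4, 1], ![2, 4]] i j : ℕ) : ℤ)) ∧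
    (∀ j : Fin 2, padicValRat (![2, 17] j) ((19652 : ℚ)) = ((![2, 3] j : ℕ) : ℤ)) := by
  haveI : Fact (Nat.Prime 2) := ⟨Nat.prime_two⟩
  haveI : Fact (Nat.Prime 17) := ⟨by norm_num⟩
  refine ⟨fun i j ↦ ?_, fun j ↦ ?_⟩
  · fin_cases i <;> fin_cases j
    · exact padicValRat_eq_of_eq (p := 2) 4 (u := 17) (1) (Or.inl rfl) (by norm_num) (by norm_num)
    · exact padicValRat_eq_of_eq (p := 17) 1 (u := 16) (1) (Or.inl rfl) (by norm_num) (by norm_num)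
    · exact padicValRat_eq_of_eq (p := 2) 2 (u := 261003125) (1) (Or.inl rfl) (by norm_num) (by norm_num)
    · exact padicValRat_eq_of_eq (p := 17) 4 (u := 12500) (1) (Or.inl rfl) (by norm_num) (by norm_num)
  · fin_cases j
    · exact padicValRat_eq_of_eq (p := 2) 2 (u := 4913) (1) (Or.inl rfl) (by norm_num) (by norm_num)
    · exact padicValRat_eq_of_eq (p := 17) 3 (u := 4) (1) (Or.inl rfl) (by norm_num) (by norm_num)

/-- **The valuation matrix mod `5` is invertible**: `M = [[2, 3], [0, 1]]` mod `5` (`v(f_T(P_i)) − v(f_T(2T))`) and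
`[[3, 1], [0, 1]] · M = 1`. [folklore] -/
private theorem matrix_surjective : ∀ e : Fin 2 → ZMod 5, ∃ c : Fin 2 → ZMod 5, Matrix.vecMul c (Matrix.of (fun i j : Fin 2 ↦
      ((padicValRat (![2, 17] j) (![(0 : ℚ), 3910] i * ![(68 : ℚ), 274550] i -
          (((2 : ℤ) : ℚ)) * ![(0 : ℚ), 3910] i ^ 2 + (((2 : ℤ) : ℚ)) ^ 2 * ![(68 : ℚ), 274550] i) -
        padicValRat (![2, 17] j) ((34 : ℚ) * 578 - (((2 : ℤ) : ℚ)) * (34) ^ 2 +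
          (((2 : ℤ) : ℚ)) ^ 2 * 578) : ℤ) : ZMod 5))) = e := by
  have hM : Matrix.of (fun i j : Fin 2 ↦
      ((padicValRat (![2, 17] j) (![(0 : ℚ), 3910] i * ![(68 : ℚ), 274550] i -
          (((2 : ℤ) : ℚ)) * ![(0 : ℚ), 3910] i ^ 2 + (((2 : ℤ) : ℚ)) ^ 2 * ![(68 : ℚ), 274550] i) -
        padicValRat (![2, 17] j) ((34 : ℚ) * 578 - (((2 : ℤ) : ℚ)) * (34) ^ 2 +
          (((2 : ℤ) : ℚ)) ^ 2 * 578) : ℤ) : ZMod 5)) =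
      !![2, 3; 0, 1] := by
    ext i j
    simp only [Matrix.of_apply]
    rw [kummerValues.1 i, kummerValues.2, valuations.1 i j, valuations.2 j]
    fin_cases i <;> fin_cases j <;> decide
  have hinv : (!![3, 1; 0, 1] : Matrix (Fin 2) (Fin 2) (ZMod 5)) * !![2, 3; 0, 1] = 1 := by decide
  intro e
  refine ⟨Matrix.vecMul e !![3, 1; 0, 1], ?_⟩
  rw [hM, Matrix.vecMul_vecMul, hinv, Matrix.vecMul_one]

/-- `S` is enumerated by `![2, 17]`. [folklore] -/
private theorem primeFactors_enum :
    (∀ j : Fin 2, ![2, 17] j ∈ ((17 : ℤ) * 2).natAbs.primeFactors) ∧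
    (∀ p ∈ ((17 : ℤ) * 2).natAbs.primeFactors, ∃ j : Fin 2, ![2, 17] j = p) := by
  refine ⟨fun j ↦ ?_, fun p hp ↦ ?_⟩
  · rw [primeFactors_eq]; fin_cases j <;> simp
  · rw [primeFactors_eq] at hp
    simp only [Finset.mem_insert, Finset.mem_singleton] at hp
    rcases hp with rfl | rfl
    · exact ⟨0, rfl⟩
    · exact ⟨1, rfl⟩

/-! ## §4 The theorems -/

/-- **`t₅(E_{17/2}) = 0`, UNCONDITIONALLY**, by the complete `5`-descent (box of two places, two points).
[cite: SilvermanAEC2009, Thm. X.4.2(a)] [cite: Fisher2001FiveSevenDescent, §2] -/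
theorem shaCorank_five_eq_zero :
    haveI := isElliptic
    (kubertTateFive (((17 : ℤ) : ℚ)) (((2 : ℤ) : ℚ))).shaCorank 5 = 0 := by
  haveI := isElliptic
  haveI : Fact (Nat.Prime 3) := ⟨by norm_num⟩
  obtain ⟨h1, h2, hb⟩ := nonsingular_points
  exact KubertTateMuDescent.shaCorank_five_eq_zero_of_matrix (17) 2
    (toGeomPoints _ (.some 3910 274550 h2)) (fun σ ↦ smul_toGeomPoints _ σ _)
    (KubertTateFiveTorsion.twentyfive_zsmul_toGeomPoints_ne_zero (17) 2 3 (by norm_num) (by norm_num)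
      not_tor_dvd_Δ (by norm_num) (by norm_num))
    not_five_dvd_Δ tame ![2, 17] primeFactors_enum.1 primeFactors_enum.2
    ![0, 3910] ![68, 274550]
    (fun i ↦ by fin_cases i <;> assumption)
    (fun i ↦ by fin_cases i <;> norm_num)
    34 578 hb (by norm_num) matrix_surjective

/-- **`Ш(E_{17/2}/ℚ)[5] = 0`, unconditionally.** [cite: SilvermanAEC2009, Thm. X.4.2(a)] -/
theorem sha_torsionBy_five_eq_bot :
    haveI := isElliptic
    (kubertTateFive (((17 : ℤ) : ℚ)) (((2 : ℤ) : ℚ))).sha[((5 : ℕ) : ℤ)] = ⊥ := by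
  haveI := isElliptic
  haveI : Fact (Nat.Prime 3) := ⟨by norm_num⟩
  obtain ⟨h1, h2, hb⟩ := nonsingular_points
  exact KubertTateMuDescent.sha_torsionBy_five_eq_bot_of_matrix (17) 2
    (toGeomPoints _ (.some 3910 274550 h2)) (fun σ ↦ smul_toGeomPoints _ σ _)
    (KubertTateFiveTorsion.twentyfive_zsmul_toGeomPoints_ne_zero (17) 2 3 (by norm_num) (by norm_num)
      not_tor_dvd_Δ (by norm_num) (by norm_num))
    not_five_dvd_Δ tame ![2, 17] primeFactors_enum.1 primeFactors_enum.2
    ![0, 3910] ![68, 274550]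
    (fun i ↦ by fin_cases i <;> assumption)
    (fun i ↦ by fin_cases i <;> norm_num)
    34 578 hb (by norm_num) matrix_surjective

/-- **`rank E_{17/2}(ℚ) = 1`, unconditionally** (the `5`-descent computes the rank: box full, tame, `#E(ℚ)[5] = 5` by reduction
modulo `3`). [cite: SilvermanAEC2009, Thm. X.4.2 and Thm. X.1.1] -/
theorem mordellWeilRank_eq :
    haveI := isElliptic
    (kubertTateFive (((17 : ℤ) : ℚ)) (((2 : ℤ) : ℚ))).mordellWeilRank = 1 := by
  haveI := isElliptic
  haveI : Fact (Nat.Prime 3) := ⟨by norm_num⟩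
  obtain ⟨h1, h2, hb⟩ := nonsingular_points
  have h := KubertTateMuDescent.mordellWeilRank_succ_eq_of_matrix (17) 2
    (toGeomPoints _ (.some 3910 274550 h2)) (fun σ ↦ smul_toGeomPoints _ σ _)
    (KubertTateFiveTorsion.twentyfive_zsmul_toGeomPoints_ne_zero (17) 2 3 (by norm_num) (by norm_num)
      not_tor_dvd_Δ (by norm_num) (by norm_num))
    not_five_dvd_Δ tame ![2, 17] primeFactors_enum.1 primeFactors_enum.2
    ![0, 3910] ![68, 274550]
    (fun i ↦ by fin_cases i <;> assumption)
    (fun i ↦ by fin_cases i <;> norm_num)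
    34 578 hb (by norm_num) matrix_surjective
    (KubertTateFiveTorsion.natCard_torsionBy_five (17) 2 3 (by norm_num) (by norm_num) not_tor_dvd_Δ)
  have hc : (((17 : ℤ) * 2).natAbs.primeFactors).card = 2 := by
    rw [primeFactors_eq]; decide
  omega

end KubertTate172Descent

end Literature.NumberTheory.EllipticCurves

end
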